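import Summits.QuantumFields.YangMills.Theorems.LangevinControlUVFemtoCurvatureTwoPointCTorusLowerAxis
import Summits.QuantumFields.YangMills.Theorems.LangevinControlUVFemtoCurvatureTwoPointCTorusUpper
import Summits.QuantumFields.YangMills.Theorems.LangevinControlUVFemtoCurvatureTwoPointCLatticeStokes
import Literature.MathematicalPhysics.QuantumFieldTheory.ConstructiveQFTWave0WilsonLoopRPProofs
import HarnessLib

/-!
# Route `LangevinControlUV`, crux `FemtoCurvatureTwoPointC` (stmt-QuantumFields-16204), line
# `conditional-covariance-floor` — V-corner: the HOLONOMY-CONDITIONED triangular upper bound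

Registered sub-goal `torus_upper_axisHolonomy` (`--supports stmt-QuantumFields-16204`), proved
verbatim: for a compact second-countable `G` with a lattice representation `r` (`D = dimE r.ρ`) there
is `C > 0` with `Z_L(b/2) ≤ (C (b/4)^{−D/2})^{3L⁴−3} · Z₁(b/(4L²))` for all `L ≥ 2`, `b ≥ 4`
(`Z₁ = partitionFunction (L := 1)`, the one-site weight of the commutator cost on `G⁴`). Upper half of
the holonomy-conditioned torus sandwich of the V-corner attack (lower half: `torus_lower_axisHolonomy`);
with the iterated one-site doubling it yields the uniform doubling on ALL boxes.

**Proof.** `e^{−(b/2)S} = e^{−(b/4)S} · e^{−(b/4)S}`: the first factor is at most the product of the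
plaquette weights at temperature `b/4` over the SHARP top-link family (`3L⁴ − 3` plaquettes); the
second is at most the SPECTATOR `g(U) = e^{−(b/(4L²)) f(h(U))}`, `h_μ(U) = lineHolonomy U μ L 0` the
based axis holonomies, by the lattice Stokes bound `f(h(U)) ≤ L² S(U)`
(`axisCommutatorCost_le_wilsonAction`). The spectator reads only AXIS links `(t e_μ, μ)`, none of which
is a top link (`torus_topLink_assignment_sharp_offAxis`), so it is a constant of the triangular
integration (`lintegral_mul_prod_le_pow_mul_lintegral`): `Z_L(b/2) ≤ z^{3L⁴−3} ∫ g` with the one-link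
bound `z = C (b/4)^{−D/2}` (`oneLinkLaplace_le_rpow`). The law of `h(U)` under product Haar is product
Haar (`map_axisHolonomy_pi_haar`: `h_μ = U(0,μ) · tail`, the tail reading only links off the origin;
`map_pi_haar_twoSided_eq` and `pi_map_proj_eq_pi`), so `∫ g = Z₁(b/(4L²))`.

Everything is proved from Mathlib and landed tree files; no named facts, no definitions.
-/

set_option autoImplicit false

noncomputable section

open scoped ENNReal
open MeasureTheory Finset
open Literature.MathematicalPhysics.QuantumFieldTheory
open Summit.QuantumFields.YangMills.Theorems.FreeEnergyLogCoefficient (dimE)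
open Summit.QuantumFields.YangMills.Theorems.FemtoCurvatureTwoPoint.PlaquetteVariance
  (partitionFunction_toReal_pos re_trace_le)

namespace Summit.QuantumFields.YangMills.Theorems.FemtoCurvatureTwoPointC.TorusGauge

/-! ### Triangular integration with a spectator -/

/-- **Triangular integration with a spectator factor**: in the setting of
`lintegral_prod_le_pow_of_rank`, a measurable spectator `g` depending only on coordinates in a set
`S` containing no top link factors out: `∫ g · ∏_{p ∈ P} w p dμ^{⊗ι} ≤ z^{#P} · ∫ g dμ^{⊗ι}`. -/
-- adapted from `lintegral_prod_le_pow_of_rank` (`…CTriangularIntegration`, p143799)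
theorem lintegral_mul_prod_le_pow_mul_lintegral :
    ∀ {ι : Type} [Fintype ι] [DecidableEq ι] {G : Type} [MeasurableSpace G] (μ : Measure G)
      [IsProbabilityMeasure μ] {κ : Type} (P : Finset κ) (links : κ → Finset ι) (top : κ → ι)
      (rk : ι → ℕ), Function.Injective rk → Set.InjOn top ↑P →
      (∀ p ∈ P, top p ∈ links p) → (∀ p ∈ P, ∀ i ∈ links p, rk i ≤ rk (top p)) →
      ∀ (w : κ → (ι → G) → ℝ≥0∞), (∀ p ∈ P, Measurable (w p)) → (∀ p ∈ P, ∀ U, w p U ≤ 1) →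
      (∀ p ∈ P, DependsOn (w p) ↑(links p)) →
      ∀ (z : ℝ≥0∞), (∀ p ∈ P, ∀ U : ι → G, ∫⁻ x, w p (Function.update U (top p) x) ∂μ ≤ z) →
      ∀ (g : (ι → G) → ℝ≥0∞), Measurable g → ∀ (S : Set ι), DependsOn g S → (∀ p ∈ P, top p ∉ S) →
      ∫⁻ U, g U * ∏ p ∈ P, w p U ∂(Measure.pi fun _ : ι => μ) ≤
        z ^ P.card * ∫⁻ U, g U ∂(Measure.pi fun _ : ι => μ) := by
  intro ι _ _ G _ μ _ κ P
  classical
  induction P using Finset.strongInduction with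
  | H P ih =>
    intro links top rk hrk htop hmem hle w hw hw1 hdep z hz g hg S hgS hS
    rcases P.eq_empty_or_nonempty with rfl | hne
    · simp
    -- the plaquette `q` of maximal top rank, and its top coordinate `i`
    obtain ⟨q, hq, hmax⟩ := P.exists_max_image (fun p => rk (top p)) hne
    set i : ι := top q
    -- no other plaquette of `P` touches the coordinate `i`, nor does the spectator
    have hnot : ∀ p ∈ P.erase q, i ∉ links p := by
      intro p hp hip
      have hpP : p ∈ P := Finset.mem_of_mem_erase hp
      have hpq : p ≠ q := Finset.ne_of_mem_erase hp
      have h1 : rk i ≤ rk (top p) := hle p hpP i hip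
      have h2 : rk (top p) ≤ rk i := hmax p hpP
      have htp : top p = top q := hrk (le_antisymm h2 h1)
      exact hpq (htop hpP hq htp)
    have hgi : ∀ (U : ι → G) (x : G), g (Function.update U i x) = g U := fun U x =>
      hgS fun j hj => Function.update_of_ne (ne_of_mem_of_not_mem hj (hS q hq)) x U
    set F : (ι → G) → ℝ≥0∞ := fun U => g U * ∏ p ∈ P.erase q, w p U with hF_def
    have hF_meas : Measurable F :=
      hg.mul (Finset.measurable_prod _ fun p hp => hw p (Finset.mem_of_mem_erase hp))
    have hFi : ∀ (U : ι → G) (x : G), F (Function.update U i x) = F U := by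
      intro U x
      simp only [hF_def]
      rw [hgi U x]
      congr 1
      refine Finset.prod_congr rfl fun p hp => ?_
      exact (hdep p (Finset.mem_of_mem_erase hp)) fun j hj =>
        Function.update_of_ne (ne_of_mem_of_not_mem hj (hnot p hp)) x U
    have hprod_meas : Measurable fun U : ι → G => g U * ∏ p ∈ P, w p U :=
      hg.mul (Finset.measurable_prod _ fun p hp => hw p hp)
    have hzF_meas : Measurable fun U : ι → G => z * F U := hF_meas.const_mul z
    have step1 :
        ∫⁻ U, g U * ∏ p ∈ P, w p U ∂(Measure.pi fun _ : ι => μ) ≤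
          ∫⁻ U, z * F U ∂(Measure.pi fun _ : ι => μ) := by
      refine lintegral_le_of_lmarginal_le {i} hprod_meas hzF_meas ?_
      rw [lmarginal_singleton, lmarginal_singleton]
      intro U
      calc ∫⁻ x, g (Function.update U i x) * ∏ p ∈ P, w p (Function.update U i x) ∂μ
          = ∫⁻ x, w q (Function.update U i x) * F U ∂μ := by
            refine lintegral_congr fun x => ?_
            rw [← Finset.mul_prod_erase P (fun p => w p (Function.update U i x)) hq, ← hFi U x]
            simp only [hF_def]
            ring
        _ = (∫⁻ x, w q (Function.update U i x) ∂μ) * F U :=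
            lintegral_mul_const _ ((hw q hq).comp (measurable_update U))
        _ ≤ z * F U := mul_le_mul' (hz q hq U) le_rfl
        _ = ∫⁻ _x, z * F U ∂μ := by rw [lintegral_const, measure_univ, mul_one]
        _ = ∫⁻ x, z * F (Function.update U i x) ∂μ := by simp_rw [hFi]
    have ihF : ∫⁻ U, F U ∂(Measure.pi fun _ : ι => μ) ≤
        z ^ (P.erase q).card * ∫⁻ U, g U ∂(Measure.pi fun _ : ι => μ) :=
      ih (P.erase q) (Finset.erase_ssubset hq) links top rk hrk
        (htop.mono (Finset.coe_subset.mpr (Finset.erase_subset q P)))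
        (fun p hp => hmem p (Finset.mem_of_mem_erase hp))
        (fun p hp => hle p (Finset.mem_of_mem_erase hp)) w
        (fun p hp => hw p (Finset.mem_of_mem_erase hp))
        (fun p hp => hw1 p (Finset.mem_of_mem_erase hp))
        (fun p hp => hdep p (Finset.mem_of_mem_erase hp)) z
        (fun p hp => hz p (Finset.mem_of_mem_erase hp)) g hg S hgS
        (fun p hp => hS p (Finset.mem_of_mem_erase hp))
    calc ∫⁻ U, g U * ∏ p ∈ P, w p U ∂(Measure.pi fun _ : ι => μ)
        ≤ ∫⁻ U, z * F U ∂(Measure.pi fun _ : ι => μ) := step1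
      _ = z * ∫⁻ U, F U ∂(Measure.pi fun _ : ι => μ) := lintegral_const_mul z hF_meas
      _ ≤ z * (z ^ (P.erase q).card * ∫⁻ U, g U ∂(Measure.pi fun _ : ι => μ)) :=
          mul_le_mul' le_rfl ihF
      _ = z ^ P.card * ∫⁻ U, g U ∂(Measure.pi fun _ : ι => μ) := by
          rw [← mul_assoc, ← pow_succ', Finset.card_erase_add_one hq]

/-! ### The sharp top-link family avoids the axis links -/

/-- A non-wrapping step in direction `μ` lands off the hyperplane `x_μ = 0`. -/
theorem shift_apply_self_ne_zero {L : ℕ} (hL : 2 ≤ L) {x : Site 4 L} {μ : Fin 4}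
    (hx : (x μ).val + 1 < L) : x.shift μ μ ≠ 0 := by
  intro h
  rw [shift_apply_self] at h
  have h2 := congrArg ZMod.val h
  rw [TopLink.val_add_one_of_lt hL hx, ZMod.val_zero] at h2
  exact Nat.succ_ne_zero _ h2

/-- **Sharp top-link assignment, off the axes**: the sharp family of `torus_topLink_assignment_sharp`
(`3L⁴ − 3` plaquettes, private top links of maximal rank), every top link `(y, μ)` having a non-zero
coordinate `y_ν`, `ν ≠ μ` (it is `(x + e_μ, ν)` or `(x + e_ν, μ)` with no wrap), hence never an axis link. -/
-- adapted from `torus_topLink_assignment_sharp` (`…CTorusTopLinkSharp`, p152623)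
theorem torus_topLink_assignment_sharp_offAxis (L : ℕ) [NeZero L] (hL : 2 ≤ L) :
    ∃ (P : Finset (Plaquette 4 L)) (top : Plaquette 4 L → Edge 4 L) (rk : Edge 4 L → ℕ),
      Function.Injective rk ∧ Set.InjOn top ↑P ∧ P.card + 3 = 3 * L ^ 4 ∧
      ∀ p ∈ P,
        (top p ∈ ({(p.1, p.2.1.1), (p.1.shift p.2.1.1, p.2.1.2), (p.1.shift p.2.1.2, p.2.1.1),
          (p.1, p.2.1.2)} : Finset (Edge 4 L)) ∧
        ∀ e ∈ ({(p.1, p.2.1.1), (p.1.shift p.2.1.1, p.2.1.2), (p.1.shift p.2.1.2, p.2.1.1),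
          (p.1, p.2.1.2)} : Finset (Edge 4 L)), rk e ≤ rk (top p)) ∧
        ∃ ν : Fin 4, ν ≠ (top p).2 ∧ (top p).1 ν ≠ 0 := by
  classical
  obtain ⟨b, w, hrk, hw, hshift, hwrap⟩ := TopLinkSharp.exists_rank (L := L) hL
  obtain ⟨B, hB_mem, hB_card⟩ := TopLink.exists_boxes (L := L)
  obtain ⟨C, hC_mem, hC_card⟩ := TopLinkSharp.exists_wrapBoxes (L := L)
  refine ⟨(univ.filter fun p : Plaquette 4 L => p.1 ∈ B p.2.1.1) ∪
      (univ.filter fun p : Plaquette 4 L => p.1 ∈ C p.2.1.1 p.2.1.2),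
    fun p => if (p.1 p.2.1.1).val + 1 < L then (p.1.shift p.2.1.1, p.2.1.2)
      else (p.1.shift p.2.1.2, p.2.1.1),
    fun e => b e.1 + w e.2, hrk, TopLinkSharp.injOn_top hL hB_mem hC_mem, ?_, fun p hp => ?_⟩
  · rw [Finset.card_union_of_disjoint (Finset.disjoint_left.2 fun p hpA hpB =>
      ((hC_mem _ _ _ p.2.2).1 (Finset.mem_filter.1 hpB).2).1
        ((hB_mem _ _).1 (Finset.mem_filter.1 hpA).2).1)]
    have h1 := TopLink.card_family hB_card
    have h2 := TopLinkSharp.card_wrapFamily hC_card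
    omega
  · dsimp only
    by_cases h : (p.1 p.2.1.1).val + 1 < L
    · rw [if_pos h]
      exact ⟨⟨by simp, TopLinkSharp.rank_le_topA hw hshift hwrap h⟩, p.2.1.1, p.2.2.ne,
        shift_apply_self_ne_zero hL h⟩
    · rw [if_neg h]
      have hpB := (Finset.mem_union.1 hp).resolve_left fun hpA =>
        h ((hB_mem _ _).1 (Finset.mem_filter.1 hpA).2).1
      have hν : (p.1 p.2.1.2).val + 1 < L := ((hC_mem _ _ _ p.2.2).1 (Finset.mem_filter.1 hpB).2).2.1
      exact ⟨⟨by simp, TopLinkSharp.rank_le_topB hshift hwrap h hν⟩, p.2.1.2, p.2.2.ne',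
        shift_apply_self_ne_zero hL hν⟩

/-! ### The based axis holonomies and their law -/

section Axis

variable {L : ℕ} {G : Type*} [Group G]

/-- Straight-line holonomies are measurable in the configuration (finite ordered products of
coordinates). -/
theorem measurable_lineHolonomy [MeasurableSpace G] [MeasurableMul₂ G] (k : Fin 4) :
    ∀ (n : ℕ) (y : Site 4 L), Measurable fun U : GaugeConfig 4 L G => lineHolonomy U k n y
  | 0, _ => by simpa only [lineHolonomy] using measurable_const
  | n + 1, y => by
    simp only [lineHolonomy]
    exact (measurable_pi_apply _).mul (measurable_lineHolonomy k n _)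

/-- The based axis holonomy `lineHolonomy U μ n 0` only reads AXIS links: links `(y, μ)` whose base
point has `y_ν = 0` for all `ν ≠ μ`. -/
theorem lineHolonomy_zero_congr_axis {U V : GaugeConfig 4 L G} (μ : Fin 4) (n : ℕ)
    (h : ∀ e : Edge 4 L, (∀ ν : Fin 4, ν ≠ e.2 → e.1 ν = 0) → U e = V e) :
    lineHolonomy U μ n 0 = lineHolonomy V μ n 0 :=
  WilsonLoopRP.lineHolonomy_congr μ n 0 fun s _ => h _ fun ν hν => by
    simp [Pi.single_eq_of_ne hν]

variable [NeZero L] [TopologicalSpace G] [IsTopologicalGroup G] [CompactSpace G] [MeasurableSpace G]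
  [BorelSpace G]

/-- **The based axis holonomies of a product-Haar configuration are independent Haar elements**
(`L ≥ 2`): `h_μ = U(0, μ) · t_μ(U)` with the tail `t_μ` reading only links based OFF the origin, so the
skew product lemma `map_pi_haar_twoSided_eq` and the reindexing `pi_map_proj_eq_pi` apply. -/
theorem map_axisHolonomy_pi_haar {G : Type} [Group G] [TopologicalSpace G] [IsTopologicalGroup G]
    [CompactSpace G] [MeasurableSpace G] [BorelSpace G] [SecondCountableTopology G]
    (L : ℕ) [NeZero L] (hL : 2 ≤ L) :
    (Measure.pi fun _ : Edge 4 L => haarProbability G).map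
        (fun (U : GaugeConfig 4 L G) (e' : Edge 4 1) => lineHolonomy U e'.2 L 0) =
      Measure.pi fun _ : Edge 4 1 => haarProbability G := by
  classical
  obtain ⟨n, rfl⟩ : ∃ n, L = n + 1 := ⟨L - 1, by omega⟩
  -- the links based off the origin, and the tails of the axis holonomies
  let s : Finset (Edge 4 (n + 1)) := univ.filter fun e => e.1 ≠ 0
  let R : GaugeConfig 4 (n + 1) G → Edge 4 (n + 1) → G := fun U e =>
    if e.1 = 0 then lineHolonomy U e.2 n ((0 : Site 4 (n + 1)).shift e.2) else 1
  have hRm : ∀ e, Measurable fun U => R U e := by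
    intro e
    by_cases he : e.1 = 0
    · simp only [R, if_pos he]
      exact measurable_lineHolonomy _ _ _
    · simp only [R, if_neg he]
      exact measurable_const
  have hRs : ∀ U V : GaugeConfig 4 (n + 1) G, (∀ e ∈ s, U e = V e) → R U = R V := by
    intro U V hUV
    funext e
    by_cases he : e.1 = 0
    · simp only [R, if_pos he]
      refine WilsonLoopRP.lineHolonomy_congr e.2 n _ fun m hm =>
        hUV _ (Finset.mem_filter.2 ⟨Finset.mem_univ _, ?_⟩)
      -- the site `e_μ + m e_μ = (m + 1) e_μ` is not the origin (`m + 1 ≤ n < n + 1`)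
      show (0 : Site 4 (n + 1)).shift e.2 + Pi.single e.2 (m : ZMod (n + 1)) ≠ 0
      rw [WilsonLoopRP.shift_add_single, zero_add]
      intro h
      have h1 := congrFun h e.2
      rw [Pi.single_eq_same, Pi.zero_apply] at h1
      have h2 := congrArg ZMod.val h1
      rw [ZMod.val_natCast, Nat.mod_eq_of_lt (by omega), ZMod.val_zero] at h2
      omega
    · simp only [R, if_neg he]
  have hskew := map_pi_haar_twoSided_eq s (fun _ _ => (1 : G)) R (fun _ => measurable_const) hRm
    (fun _ _ _ => rfl) hRs
  -- reindex the links at the origin by `Edge 4 1`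
  let j : Edge 4 1 → {e : Edge 4 (n + 1) // e ∉ s} := fun e' =>
    ⟨((0 : Site 4 (n + 1)), e'.2), by simp [s]⟩
  have hj : Function.Injective j := fun e₁ e₂ h =>
    Prod.ext (Subsingleton.elim _ _) (congrArg (fun i : {e : Edge 4 (n + 1) // e ∉ s} => i.1.2) h)
  have hproj := pi_map_proj_eq_pi (haarProbability G) hj
  have hΦm : Measurable fun (U : GaugeConfig 4 (n + 1) G) (i : {e : Edge 4 (n + 1) // e ∉ s}) =>
      (1 : G) * U i * R U i :=
    measurable_pi_lambda _ fun i => (measurable_const.mul (measurable_pi_apply _)).mul (hRm _)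
  have hPm : Measurable fun (W : {e : Edge 4 (n + 1) // e ∉ s} → G) (e' : Edge 4 1) => W (j e') :=
    measurable_pi_lambda _ fun e' => measurable_pi_apply _
  -- the axis-holonomy map is the composite `projection ∘ skew translation`
  have hcomp : (fun (U : GaugeConfig 4 (n + 1) G) (e' : Edge 4 1) => lineHolonomy U e'.2 (n + 1) 0) =
      (fun (W : {e : Edge 4 (n + 1) // e ∉ s} → G) (e' : Edge 4 1) => W (j e')) ∘
        (fun (U : GaugeConfig 4 (n + 1) G) (i : {e : Edge 4 (n + 1) // e ∉ s}) =>
          (1 : G) * U i * R U i) := by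
    funext U e'
    simp only [Function.comp_apply, j, R, if_true, one_mul, lineHolonomy]
  rw [hcomp, ← Measure.map_map hPm hΦm, hskew, hproj]

end Axis

/-! ### The registered statement -/

/-- **Holonomy-conditioned triangular upper bound for the torus partition function** (registered
sub-goal `torus_upper_axisHolonomy` of line `conditional-covariance-floor`, V-corner attack; the
signature verbatim): there is `C > 0` (the one-link Laplace constant) with
`Z_L(b/2) ≤ (C (b/4)^{−D/2})^{3L⁴−3} · Z₁(b/(4L²))` for all `L ≥ 2`, `b ≥ 4`, `D = dimE r.ρ`,
`Z₁ = partitionFunction (L := 1)` — see the module docstring. -/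
theorem torus_upper_axisHolonomy :
    ∀ {G : Type} [Group G] [TopologicalSpace G] [IsTopologicalGroup G] [CompactSpace G]
      [MeasurableSpace G] [BorelSpace G] [SecondCountableTopology G] (r : LatticeRep G),
      ∃ C : ℝ, 0 < C ∧ ∀ (L : ℕ) [NeZero L] (b : ℝ), 2 ≤ L → 4 ≤ b →
        (partitionFunction (d := 4) (L := L) r.ρ (b / 2)).toReal ≤
          (C * (b / 4) ^ (-((dimE r.ρ : ℝ) / 2))) ^ (3 * L ^ 4 - 3) *
            (partitionFunction (d := 4) (L := 1) r.ρ (b / (4 * (L : ℝ) ^ 2))).toReal := by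
  intro G _ _ _ _ _ _ _ r
  classical
  obtain ⟨C, hC, hlap⟩ :=
    FemtoCurvatureTwoPointC.oneLinkLaplace_le_rpow r.ρ r.continuous r.injective r.mem_unitary
  refine ⟨C, hC, fun L _ b hL hb => ?_⟩
  obtain ⟨P, top, rk, hrk, htop, hcard, hP⟩ := torus_topLink_assignment_sharp_offAxis L hL
  have hb4 : 1 ≤ b / 4 := by linarith
  have hb40 : 0 ≤ b / 4 := by linarith
  have hz0 : 0 ≤ C * (b / 4) ^ (-((dimE r.ρ : ℝ) / 2)) :=
    (mul_pos hC (Real.rpow_pos_of_pos (by linarith) _)).le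
  set t : ℝ := b / (4 * (L : ℝ) ^ 2) with ht
  have ht0 : 0 ≤ t := by positivity
  let links : Plaquette 4 L → Finset (Edge 4 L) := fun p =>
    {(p.1, p.2.1.1), (p.1.shift p.2.1.1, p.2.1.2), (p.1.shift p.2.1.2, p.2.1.1), (p.1, p.2.1.2)}
  let w : Plaquette 4 L → GaugeConfig 4 L G → ℝ≥0∞ := fun p U => ENNReal.ofReal
    (Real.exp (-(b / 4 * ((r.N : ℝ) - (r.ρ (plaquetteHolonomy U p.1 p.2.1.1 p.2.1.2)).trace.re))))
  let Ψ : GaugeConfig 4 L G → GaugeConfig 4 1 G := fun U e' => lineHolonomy U e'.2 L 0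
  let g : GaugeConfig 4 L G → ℝ≥0∞ := fun U =>
    ENNReal.ofReal (Real.exp (-t * wilsonAction r.ρ (Ψ U)))
  have hw1 : ∀ (p : Plaquette 4 L) (U : GaugeConfig 4 L G), w p U ≤ 1 := fun p U =>
    TorusUpper.ofReal_boltzmann_le_one r.ρ r.continuous hb40 _
  have hΨm : Measurable Ψ := measurable_pi_lambda _ fun e' => measurable_lineHolonomy _ _ _
  have hEm : Measurable fun V : GaugeConfig 4 1 G =>
      ENNReal.ofReal (Real.exp (-t * wilsonAction r.ρ V)) :=
    ENNReal.measurable_ofReal.comp (Real.measurable_exp.comp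
      ((WilsonRP.measurable_wilsonAction r.ρ r.continuous).const_mul _))
  have hgm : Measurable g := hEm.comp hΨm
  -- (1) pointwise: `e^{-(b/2) S} ≤ g · ∏_{p ∈ P} w_p`
  have hpt : ∀ U : GaugeConfig 4 L G,
      ENNReal.ofReal (Real.exp (-(b / 2) * wilsonAction r.ρ U)) ≤ g U * ∏ p ∈ P, w p U := by
    intro U
    have hSt := axisCommutatorCost_le_wilsonAction r.ρ r.mem_unitary U
    rw [← OneSite.wilsonAction_eq_commutatorCost r.ρ (Ψ U)] at hSt
    have hS0 : 0 ≤ wilsonAction r.ρ U := Finset.sum_nonneg fun p _ =>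
      sub_nonneg.2 (re_trace_le r.ρ r.continuous _)
    have h1 : Real.exp (-(b / 4) * wilsonAction r.ρ U) ≤ Real.exp (-t * wilsonAction r.ρ (Ψ U)) := by
      refine Real.exp_le_exp.2 ?_
      have : t * wilsonAction r.ρ (Ψ U) ≤ t * ((L : ℝ) ^ 2 * wilsonAction r.ρ U) :=
        mul_le_mul_of_nonneg_left hSt ht0
      have hcancel : t * ((L : ℝ) ^ 2 * wilsonAction r.ρ U) = b / 4 * wilsonAction r.ρ U := by
        rw [ht]
        field_simp
      linarith
    have h2 : ENNReal.ofReal (Real.exp (-(b / 4) * wilsonAction r.ρ U)) ≤ ∏ p ∈ P, w p U := by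
      have hall : ENNReal.ofReal (Real.exp (-(b / 4) * wilsonAction r.ρ U)) = ∏ p, w p U := by
        rw [← ENNReal.ofReal_prod_of_nonneg fun p _ => (Real.exp_pos _).le, ← Real.exp_sum]
        congr 1
        rw [wilsonAction, neg_mul, Finset.mul_sum, ← Finset.sum_neg_distrib]
      rw [hall]
      exact Finset.prod_le_prod_of_subset_of_le_one' (Finset.subset_univ P) fun p _ _ => hw1 p U
    calc ENNReal.ofReal (Real.exp (-(b / 2) * wilsonAction r.ρ U))
        = ENNReal.ofReal (Real.exp (-(b / 4) * wilsonAction r.ρ U)) *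
            ENNReal.ofReal (Real.exp (-(b / 4) * wilsonAction r.ρ U)) := by
          rw [← ENNReal.ofReal_mul (Real.exp_pos _).le, ← Real.exp_add]
          congr 2
          ring
      _ ≤ g U * ∏ p ∈ P, w p U :=
          mul_le_mul' (ENNReal.ofReal_le_ofReal h1) h2
  -- (2) triangular integration with the spectator
  have hmain : ∫⁻ U, g U * ∏ p ∈ P, w p U ∂(Measure.pi fun _ : Edge 4 L => haarProbability G) ≤
      ENNReal.ofReal (C * (b / 4) ^ (-((dimE r.ρ : ℝ) / 2))) ^ P.card *
        ∫⁻ U, g U ∂(Measure.pi fun _ : Edge 4 L => haarProbability G) := by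
    refine lintegral_mul_prod_le_pow_mul_lintegral (haarProbability G) P links top rk hrk htop
      (fun p hp => (hP p hp).1.1) (fun p hp => (hP p hp).1.2) w
      (fun p _ => TorusUpper.measurable_weight r.ρ r.continuous (b / 4) p) (fun p _ U => hw1 p U)
      (fun p _ U V hUV => ?_) _ (fun p hp U => ?_) g hgm
      {e : Edge 4 L | ∀ ν : Fin 4, ν ≠ e.2 → e.1 ν = 0} (fun U V hUV => ?_) (fun p hp hmem => ?_)
    · -- the weight of `p` depends only on the four links of `p`
      show ENNReal.ofReal _ = ENNReal.ofReal _
      rw [TorusUpper.plaquetteHolonomy_eq_of_eqOn p fun e he => hUV e (Finset.mem_coe.2 he)]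
    · -- integrating out the top link of `p` gives the one-link Laplace integral at `b/4 ≥ 1`
      show ∫⁻ x, ENNReal.ofReal (Real.exp (-(b / 4 * ((r.N : ℝ) -
          (r.ρ (plaquetteHolonomy (Function.update U (top p) x) p.1 p.2.1.1 p.2.1.2)).trace.re))))
          ∂haarProbability G ≤ _
      rw [TorusUpper.lintegral_update_plaquetteHolonomy
          (TorusUpper.measurable_ofReal_boltzmann r.ρ r.continuous (b / 4)) hL U p (hP p hp).1.1,
        TorusUpper.lintegral_ofReal_boltzmann r.ρ r.continuous (b / 4)]
      exact ENNReal.ofReal_le_ofReal (hlap (b / 4) hb4)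
    · -- the spectator reads only axis links
      show ENNReal.ofReal (Real.exp (-t * wilsonAction r.ρ (Ψ U))) =
        ENNReal.ofReal (Real.exp (-t * wilsonAction r.ρ (Ψ V)))
      have hΨ : Ψ U = Ψ V := funext fun e' => lineHolonomy_zero_congr_axis e'.2 L fun e he => hUV e he
      rw [hΨ]
    · -- no top link is an axis link
      obtain ⟨ν, hν, hne⟩ := (hP p hp).2
      exact hne (hmem ν hν)
  -- (3) the spectator integrates to the one-site partition function
  have hspec : ∫⁻ U, g U ∂(Measure.pi fun _ : Edge 4 L => haarProbability G) =
      partitionFunction (d := 4) (L := 1) r.ρ t := by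
    show ∫⁻ U, ENNReal.ofReal (Real.exp (-t * wilsonAction r.ρ (Ψ U))) ∂_ = _
    rw [OneSite.partitionFunction_eq_lintegral', ← map_axisHolonomy_pi_haar (G := G) L hL,
      lintegral_map hEm hΨm]
  have hcardP : P.card = 3 * L ^ 4 - 3 := by omega
  have hZ : partitionFunction (d := 4) (L := L) r.ρ (b / 2) ≤
      ENNReal.ofReal (C * (b / 4) ^ (-((dimE r.ρ : ℝ) / 2))) ^ P.card *
        partitionFunction (d := 4) (L := 1) r.ρ t := by
    rw [OneSite.partitionFunction_eq_lintegral' r.ρ (b / 2), ← hspec]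
    exact (lintegral_mono fun U => hpt U).trans hmain
  have hZ1pos := partitionFunction_toReal_pos (d := 4) (L := 1) r.ρ r.continuous t
  have hZ1top : partitionFunction (d := 4) (L := 1) r.ρ t ≠ ⊤ := (ENNReal.toReal_pos_iff.1 hZ1pos).2.ne
  have htop : ENNReal.ofReal (C * (b / 4) ^ (-((dimE r.ρ : ℝ) / 2))) ^ P.card *
      partitionFunction (d := 4) (L := 1) r.ρ t ≠ ⊤ :=
    ENNReal.mul_ne_top (ENNReal.pow_ne_top ENNReal.ofReal_ne_top) hZ1top
  calc (partitionFunction (d := 4) (L := L) r.ρ (b / 2)).toReal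
      ≤ (ENNReal.ofReal (C * (b / 4) ^ (-((dimE r.ρ : ℝ) / 2))) ^ P.card *
          partitionFunction (d := 4) (L := 1) r.ρ t).toReal := ENNReal.toReal_mono htop hZ
    _ = (C * (b / 4) ^ (-((dimE r.ρ : ℝ) / 2))) ^ (3 * L ^ 4 - 3) *
          (partitionFunction (d := 4) (L := 1) r.ρ t).toReal := by
        rw [ENNReal.toReal_mul, ENNReal.toReal_pow, ENNReal.toReal_ofReal hz0, hcardP]

end Summit.QuantumFields.YangMills.Theorems.FemtoCurvatureTwoPointC.TorusGauge

end
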